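import Mathlib
import Summits.ValiantsHypothesis.ValiantsHypothesis.Cruxes.NNLinearDegreeCofactorHard.Lines.xc_division
import Summits.ValiantsHypothesis.ValiantsHypothesis.Theorems.FifoMatchingXcMinkowskiMultiplesHard
import Literature.Barriers.PneNP.ExtendedFormulationMinkowskiFaces
import Literature.Barriers.PneNP.ExtendedFormulationLinearImage
import HarnessLib

/-!
# val-idea-42 g0 — card `virtual-passenger-law`, the BUDGETED TRANSPORT (crux stmt-ValiantsHypothesis-21181)

The transport of record (`xc_division.lean` §§7–8: `transport_step`, `transport_geometric`, `xcTransport_holds`)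
re-run WITH THE PASSENGER'S OWN EF BUDGET threaded through every step (face ∘ linear image preserve EF size on
the passenger side too).  Result, sorry-free:

* `transport_step_budget`, `transport_geometric_budget` — the located-face steps return, besides the EF of
  `COR + conv{q'}`, an EF of `conv{q'}` of the passenger's old budget;
* `xcVirtualTransport_holds : CorVirtualHard → XcVirtualHard`;
* `nnDivisionHard_of_xcVirtual : XcVirtualHard → Theses.FifoMatching.NNDivisionHard` (keeps the crux's `+ L₊(h)`:
  `xc(Newt h) ≤ 3·L₊(h)`, HY21 Thm 35);
* ★ `nnDivisionHard_of_corVirtual : CorVirtualHard → Theses.FifoMatching.NNDivisionHard` — the crux follows BY NAME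
  from the BUDGETED law alone («vxc(COR(K_h)) is super-quasi-polynomial», Hertrich–Loho 2024 Q5.1 at P = COR),
  which is WEAKER than COR-MINKOWSKI (`corVirtualHard_of_corMinkowski`).

Nothing here proves 21181, COR-MINKOWSKI or VP ≠ VNP; `CorVirtualHard` is OPEN.
-/

namespace Summit.ValiantsHypothesis.ValiantsHypothesis.Cruxes.NNLinearDegreeCofactorHard.XcDivision

open Matrix Finset MvPolynomial
open scoped NNReal Pointwise
open Literature.Barriers.PneNP (HasEFOfSize)
open Literature.Combinatorics.Optimization (corPolytopeGraph)
open Literature.Computability.AlgebraicComplexity (complexity nestFreeMatchingPoly)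
open Literature.Computability.AlgebraicComplexity.MonotoneCircuitEF (hasEFOfSize_newtonPolytope_complexity)
open Literature.Algebra.Polynomial.NewtonPolytope (newtonPolytope)
open Summit.ValiantsHypothesis.ValiantsHypothesis.Theorems.FifoMatching.XcDivision
  (hasEFOfSize_minkowski_of_complexity_le)
open Summit.ValiantsHypothesis.ValiantsHypothesis.Theorems.FifoMatching.QueueGridFace
  (realOf suppPts newt QGV patternVec queueGridPP corMap corMap_image_queueGridPP newt_nonneg)
open Summit.ValiantsHypothesis.ValiantsHypothesis.Theorems.FifoMatching.GridCorShadow (queueGridZeroOnePoints_holds)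
open Summit.ValiantsHypothesis.ValiantsHypothesis.Theorems.FifoMatching.MonomialCofactor (newt_eq_newtonPolytope)
open Literature.Combinatorics.Optimization (AboulkerEtAl2019_gridCorCliqueFace)
open Literature.Computability.MetaComplexity (gridGraph)

namespace Budget

/-! ## The budgeted statements -/

/-- **XC-VIRTUAL (budgeted XC-MINKOWSKI)**: eventually in `n`, no `NFP_n + Newt(h)` whose passenger `Newt(h)`
ITSELF has an EF of size `3·T c n` has an EF of size `3·T c n`. -/
def XcVirtualHard : Prop :=
  ∀ c : ℕ, ∃ n₀ : ℕ, ∀ n ≥ n₀, ∀ h : MvPolynomial (Fin (2 * n) × Fin (2 * n)) ℝ≥0, h ≠ 0 →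
    HasEFOfSize (newtR h) (3 * T c n) →
    ¬ HasEFOfSize (newtR (nestFreeMatchingPoly n ℝ≥0) + newtR h) (3 * T c n)

/-- **COR-VIRTUAL (the budgeted law; = vxc(COR(K_h)) super-quasi-polynomial, Hertrich–Loho Q5.1 at COR)**. -/
def CorVirtualHard : Prop :=
  ∀ c : ℕ, ∃ h₀ : ℕ, ∀ h ≥ h₀, ∀ (K : ℕ) (q : Fin (K + 1) → (Fin h × Fin h → ℝ)) (r : ℕ),
    HasEFOfSize (convexHull ℝ (Set.range q)) r →
    HasEFOfSize (corPolytopeGraph (⊤ : SimpleGraph (Fin h)) + convexHull ℝ (Set.range q)) r → T c h < r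

/-- the law of record implies the budgeted law. -/
theorem corVirtualHard_of_corMinkowski (hC : CorMinkowskiHard) : CorVirtualHard := by
  intro c
  obtain ⟨h₀, hh₀⟩ := hC c
  exact ⟨h₀, fun h hh K q r _ hEF => hh₀ h hh K q r hEF⟩

/-- ★ XC-VIRTUAL ⇒ the crux BY NAME (the crux charges `L₊(h)`; `xc(Newt h) ≤ 3·L₊(h)`, HY21 Thm 35). -/
theorem nnDivisionHard_of_xcVirtual (hX : XcVirtualHard) :
    Summit.ValiantsHypothesis.ValiantsHypothesis.Theses.FifoMatching.NNDivisionHard := by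
  intro c
  obtain ⟨n₀, hn₀⟩ := hX c
  refine ⟨n₀, fun n hn h hh => ?_⟩
  by_contra hlt
  have hle : complexity (nestFreeMatchingPoly n ℝ≥0 * h) + complexity h ≤ T c n := not_lt.mp hlt
  have h1 : complexity (nestFreeMatchingPoly n ℝ≥0 * h) ≤ T c n := le_trans (Nat.le_add_right _ _) hle
  have h2 : complexity h ≤ T c n := le_trans (Nat.le_add_left _ _) hle
  exact hn₀ n hn h hh ((hasEFOfSize_newtonPolytope_complexity h).of_le (by omega))
    (hasEFOfSize_minkowski_of_complexity_le n h h1)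

/-! ## The budgeted transport steps -/

/-- **ONE TRANSPORT STEP, WITH BUDGET**: as `transport_step`, and the new passenger `conv{q'}` (a linear image of
a face of the old one) keeps the old passenger's EF budget. -/
theorem transport_step_budget {ι κ J : Type} [Fintype ι] [Fintype κ] [Fintype J] [Nonempty J]
    {P : Set (ι → ℝ)} (q : J → ι → ℝ) {r r' : ℕ} (h : HasEFOfSize (P + convexHull ℝ (Set.range q)) r)
    (hB : HasEFOfSize (convexHull ℝ (Set.range q)) r')
    (w : ι → ℝ) (δ : ℝ) (hP : ∀ x ∈ P, w ⬝ᵥ x ≤ δ) (L : (ι → ℝ) →ₗ[ℝ] (κ → ℝ)) :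
    ∃ (K : ℕ) (q' : Fin (K + 1) → κ → ℝ),
      HasEFOfSize (L '' (P ∩ {x | w ⬝ᵥ x = δ}) + convexHull ℝ (Set.range q')) r ∧
      HasEFOfSize (convexHull ℝ (Set.range q')) r' := by
  classical
  obtain ⟨j₀, -, hj₀⟩ :=
    Finset.exists_max_image Finset.univ (fun j => w ⬝ᵥ q j) Finset.univ_nonempty
  have hle : ∀ j, w ⬝ᵥ q j ≤ w ⬝ᵥ q j₀ := fun j => hj₀ j (Finset.mem_univ _)
  have hQ : ∀ y ∈ convexHull ℝ (Set.range q), w ⬝ᵥ y ≤ w ⬝ᵥ q j₀ :=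
    dot_le_of_mem_convexHull _ w _ (by rintro _ ⟨j, rfl⟩; exact hle j)
  have h2 := hasEFOfSize_image_add (hasEFOfSize_face_add h w δ _ hP hQ) L
  rw [convexHull_range_inter_eq q w _ hle, LinearMap.image_convexHull, ← Set.range_comp] at h2
  have hB2 := (hB.inter_eq w (w ⬝ᵥ q j₀)).image_linearMap L
  rw [convexHull_range_inter_eq q w _ hle, LinearMap.image_convexHull, ← Set.range_comp] at hB2
  haveI : Nonempty {j : J // w ⬝ᵥ q j = w ⬝ᵥ q j₀} := ⟨⟨j₀, rfl⟩⟩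
  obtain ⟨K, q', hq'⟩ := exists_fin_range_eq (L ∘ fun j : {j : J // w ⬝ᵥ q j = w ⬝ᵥ q j₀} => q j.1)
  exact ⟨K, q', by rw [hq']; exact h2, by rw [hq']; exact hB2⟩

/-- **THE GEOMETRIC TRANSPORT, WITH BUDGET**: as `transport_geometric`, plus: an EF of `Newt(h)` of size `s'`
yields an EF of the final passenger `conv{q}` of size `s'`. -/
theorem transport_geometric_budget :
    ∃ c : ℝ, 0 < c ∧ ∃ t₀ : ℕ, ∀ (n r g : ℕ), 1 ≤ r → (r + 1) * (2 * r + 1) ≤ n → ∀ (hg : 2 * g ≤ r), t₀ ≤ g →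
      ∀ (hh : MvPolynomial (Fin (2 * n) × Fin (2 * n)) ℝ≥0), hh ≠ 0 → ∀ s s' : ℕ,
        HasEFOfSize (newtR (nestFreeMatchingPoly n ℝ≥0) + newtR hh) s → HasEFOfSize (newtR hh) s' →
          ∃ h : ℕ, c * g ≤ h ∧ ∃ (K : ℕ) (q : Fin (K + 1) → (Fin h × Fin h → ℝ)),
            HasEFOfSize (corPolytopeGraph (⊤ : SimpleGraph (Fin h)) + convexHull ℝ (Set.range q)) s ∧
            HasEFOfSize (convexHull ℝ (Set.range q)) s' := by
  classical
  obtain ⟨c, hc, t₀, hface⟩ := AboulkerEtAl2019_gridCorCliqueFace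
  refine ⟨c, hc, t₀, fun n r g hr hn hg ht hh hh0 s s' hEF hB => ?_⟩
  -- Step 0: Newton polytopes as hulls of their support points
  have hEF' : HasEFOfSize (newt (nestFreeMatchingPoly n ℝ≥0) + newt hh) s := by
    rw [newt_eq_newtonPolytope, newt_eq_newtonPolytope]; exact hEF
  have hB' : HasEFOfSize (newt hh) s' := by
    rw [newt_eq_newtonPolytope]; exact hB
  haveI : Nonempty hh.support := (MvPolynomial.support_nonempty.2 hh0).coe_sort
  let q₀ : hh.support → (Fin (2 * n) × Fin (2 * n)) → ℝ := fun d => realOf d.1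
  have hQ : newt hh = convexHull ℝ (Set.range q₀) := by
    unfold newt suppPts; rw [Set.image_eq_range]; rfl
  rw [hQ] at hEF' hB'
  -- Step 1: the A1 coordinate face, read out onto `PP_r`
  obtain ⟨Z, f, hA1⟩ := queueGridZeroOnePoints_holds r n hr hn
  let w : (Fin (2 * n) × Fin (2 * n)) → ℝ := fun e => if e ∈ Z then (-1 : ℝ) else 0
  have hw : ∀ x : (Fin (2 * n) × Fin (2 * n)) → ℝ, w ⬝ᵥ x = -∑ e ∈ Z, x e := by
    intro x
    simp only [dotProduct, w, ite_mul, neg_one_mul, zero_mul]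
    rw [Finset.sum_ite_mem, Finset.univ_inter, Finset.sum_neg_distrib]
  have hP : ∀ x ∈ newt (nestFreeMatchingPoly n ℝ≥0), w ⬝ᵥ x ≤ 0 := fun x hx => by
    rw [hw]; exact neg_nonpos.2 (Finset.sum_nonneg fun e _ => newt_nonneg _ x hx e)
  let Lf : ((Fin (2 * n) × Fin (2 * n)) → ℝ) →ₗ[ℝ] ((QGV r × QGV r) × Bool × Bool → ℝ) :=
    LinearMap.funLeft ℝ ℝ f
  obtain ⟨K₁, q₁, h₁, hB₁⟩ := transport_step_budget q₀ hEF' hB' w 0 hP Lf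
  have hF : Lf '' (newt (nestFreeMatchingPoly n ℝ≥0) ∩ {x | w ⬝ᵥ x = 0}) = queueGridPP r := by
    rw [newt_inter_zeroSet_eq, LinearMap.image_convexHull]
    unfold queueGridPP
    congr 1
  rw [hF] at h₁
  -- Step 2: c1's coordinate-linear map onto `COR(G_g)` (the passenger goes along: a linear image keeps its budget)
  have h₂ := hasEFOfSize_image_add h₁ (corMap r g hg)
  rw [corMap_image_queueGridPP, LinearMap.image_convexHull, ← Set.range_comp,
    ← Summit.ValiantsHypothesis.ValiantsHypothesis.Theorems.FifoMatching.QueueGridFace.corPolytopeGraph_eq] at h₂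
  have hB₂ := hB₁.image_linearMap (corMap r g hg)
  rw [LinearMap.image_convexHull, ← Set.range_comp] at hB₂
  -- Step 3: AFHMS's face of `COR(G_g)` onto `COR(K_h)`, as ONE valid functional
  obtain ⟨h, hch, k, cv, δ, π, hvalid, hπ⟩ := hface g ht
  obtain ⟨K₃, q₃, h₃, hB₃⟩ := transport_step_budget (⇑(corMap r g hg) ∘ q₁) h₂ hB₂ (fun e => ∑ i, cv i e)
    (∑ i, δ i) (sum_dotProduct_le _ cv δ hvalid) π
  rw [← inter_forall_eq_inter_sum _ cv δ hvalid, hπ] at h₃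
  exact ⟨h, hch, K₃, q₃, h₃, hB₃⟩

/-- ★ **THE BUDGETED TRANSPORT IS A THEOREM**: COR-VIRTUAL ⇒ XC-VIRTUAL. -/
theorem xcVirtualTransport_holds : CorVirtualHard → XcVirtualHard := by
  intro hK c
  obtain ⟨cA, hcA, t₀, htrans⟩ := transport_geometric_budget
  obtain ⟨h₀, hh₀⟩ := hK (4 ^ (c + 1) + c + 1)
  -- constants
  set cm : ℝ := min cA 1 with hcm
  have hcm0 : 0 < cm := lt_min hcA one_pos
  have hcmA : cm ≤ cA := min_le_left _ _
  have hcm1 : cm ≤ 1 := min_le_right _ _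
  obtain ⟨S₁, hS₁⟩ := exists_nat_ge ((20 / cm) ^ 2)
  obtain ⟨S₀, hS₀a, hS₀b, hS₀c, hS₀d⟩ :
      ∃ S₀ : ℕ, 4 * t₀ + 4 ≤ S₀ ∧ h₀ ^ 2 ≤ S₀ ∧ S₁ ≤ S₀ ∧ 16 ≤ S₀ :=
    ⟨4 * t₀ + 4 + h₀ ^ 2 + S₁ + 16, by omega, by omega, by omega, by omega⟩
  refine ⟨S₀ ^ 2, fun n hn hh hh0 hB hEF => ?_⟩
  obtain ⟨s, hs⟩ : ∃ s, s = Nat.sqrt n := ⟨_, rfl⟩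
  have hsS : S₀ ≤ s := by rw [hs]; exact Nat.le_sqrt'.2 hn
  have hss : s ^ 2 ≤ n := by rw [hs]; exact Nat.sqrt_le' n
  have hns : n < (s + 1) ^ 2 := by rw [hs]; exact Nat.lt_succ_sqrt' n
  obtain ⟨g, hg⟩ : ∃ g, g = s / 4 := ⟨_, rfl⟩
  have h4g : 4 * g ≤ s := by rw [hg]; exact Nat.mul_div_le s 4
  have hg4 : s < 4 * (g + 1) := by rw [hg]; omega
  have hg1 : 1 ≤ g := by omega
  have hgt : t₀ ≤ g := by omega
  have hn' : (2 * g + 1) * (2 * (2 * g) + 1) ≤ n := by nlinarith [Nat.mul_le_mul h4g h4g]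
  obtain ⟨h, hch, K, q, hEF', hBq⟩ :=
    htrans n (2 * g) g (by omega) hn' (le_refl _) hgt hh hh0 (3 * T c n) (3 * T c n) hEF hB
  -- `h` is large: `h ≥ √s + 1`
  have hsqrt_s : Real.sqrt s * Real.sqrt s = s := Real.mul_self_sqrt (Nat.cast_nonneg s)
  have hreal : Real.sqrt s + 1 ≤ (h : ℝ) := by
    have hS₁s : ((20 / cm) ^ 2 : ℝ) ≤ s := le_trans hS₁ (by exact_mod_cast (show S₁ ≤ s by omega))
    have hsq : 20 / cm ≤ Real.sqrt s := by
      rw [show (20 / cm : ℝ) = Real.sqrt ((20 / cm) ^ 2) by rw [Real.sqrt_sq (by positivity)]]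
      exact Real.sqrt_le_sqrt hS₁s
    have h20 : 20 ≤ cm * Real.sqrt s := by
      have := mul_le_mul_of_nonneg_left hsq hcm0.le
      rwa [show cm * (20 / cm) = 20 by field_simp] at this
    have hg_real : (s : ℝ) / 4 - 1 ≤ g := by
      have : (s : ℝ) < 4 * ((g : ℝ) + 1) := by exact_mod_cast hg4
      linarith
    have h1 : cm * ((s : ℝ) / 4 - 1) ≤ h :=
      calc cm * ((s : ℝ) / 4 - 1) ≤ cm * g := mul_le_mul_of_nonneg_left hg_real hcm0.le
        _ ≤ cA * g := mul_le_mul_of_nonneg_right hcmA (Nat.cast_nonneg g)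
        _ ≤ h := hch
    have h2 : 20 * Real.sqrt s ≤ cm * s := by
      have := mul_le_mul_of_nonneg_right h20 (Real.sqrt_nonneg s)
      rw [mul_assoc, hsqrt_s] at this
      exact this
    have hs1 : 1 ≤ Real.sqrt s := by
      rw [show (1 : ℝ) = Real.sqrt 1 by simp]
      exact Real.sqrt_le_sqrt (by exact_mod_cast (show 1 ≤ s by omega))
    nlinarith
  -- consequences in ℕ: `h ≥ h₀` and `n < h⁴`
  have hh₀' : h₀ ≤ h := by
    have : (h₀ : ℝ) ≤ Real.sqrt s := by
      rw [show (h₀ : ℝ) = Real.sqrt ((h₀ : ℝ) ^ 2) by rw [Real.sqrt_sq (Nat.cast_nonneg _)]]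
      exact Real.sqrt_le_sqrt (by exact_mod_cast (show h₀ ^ 2 ≤ s by omega))
    exact_mod_cast (by linarith : (h₀ : ℝ) ≤ h)
  have hn4 : n < h ^ 4 := by
    have hs1 : s + 1 ≤ h ^ 2 := by
      have : (s : ℝ) + 1 ≤ (h : ℝ) ^ 2 := by nlinarith [Real.sqrt_nonneg s]
      exact_mod_cast this
    calc n < (s + 1) ^ 2 := hns
      _ ≤ (h ^ 2) ^ 2 := Nat.pow_le_pow_left hs1 2
      _ = h ^ 4 := by rw [← pow_mul]
  have hn0 : n ≠ 0 := by
    have : 16 ^ 2 ≤ s ^ 2 := Nat.pow_le_pow_left (by omega) 2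
    omega
  have hT := T_pow_four_le (c := c) hn0 hn4
  have hlt := hh₀ h hh₀' K q (3 * T c n) hBq hEF'
  have hT2 : 2 ≤ T c n := by
    show 2 ^ 1 ≤ 2 ^ _
    exact Nat.pow_le_pow_right (by norm_num)
      (Nat.one_le_pow _ _ (by
        have h256 : 16 ^ 2 ≤ S₀ ^ 2 := Nat.pow_le_pow_left hS₀d 2
        have := Nat.log_pos one_lt_two (show 2 ≤ n by omega)
        omega))
  have h8 : 8 * T c n ≤ (T c n) ^ 4 := by
    have : 2 ^ 3 ≤ (T c n) ^ 3 := Nat.pow_le_pow_left hT2 3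
    calc 8 * T c n = 2 ^ 3 * T c n := by norm_num
      _ ≤ (T c n) ^ 3 * T c n := Nat.mul_le_mul_right _ this
      _ = (T c n) ^ 4 := by ring
  omega

/-- ★★ **COR-VIRTUAL ⇒ stmt-ValiantsHypothesis-21181 BY NAME, unconditionally in everything else**: the crux
follows from the BUDGETED law («vxc(COR(K_h)) super-quasi-polynomial») alone. -/
theorem nnDivisionHard_of_corVirtual (hC : CorVirtualHard) :
    Summit.ValiantsHypothesis.ValiantsHypothesis.Theses.FifoMatching.NNDivisionHard :=
  nnDivisionHard_of_xcVirtual (xcVirtualTransport_holds hC)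

end Budget

end Summit.ValiantsHypothesis.ValiantsHypothesis.Cruxes.NNLinearDegreeCofactorHard.XcDivision
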